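import Literature.Computability.Complexity.DecisionTreeOSSSCovariance
import Literature.Computability.Complexity.KKLTheorem
import HarnessLib

/-!
# The OSSS inequality `Var[f] ≤ Σⱼ δⱼ(t)·Infⱼ[f]` for Boolean functions computed by a `DecisionTree`

Topic `Literature/Computability/Complexity` (sequel of `DecisionTreeOSSSCovariance.lean`).  O'Donnell–Saks–Schramm–Servedio's
theorem "every decision tree has an influential variable" in its textbook one-function form (O'Donnell 2014, §8.6, "OSSS
Inequality"; FOCS 2005 Thm 1.1): for a `±1`-valued `f : {0,1}^N → {±1}` computed by a deterministic decision tree `t`,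

  `Var[f] ≤ Σⱼ δⱼ(t) · Infⱼ[f]`,   `δⱼ(t) = Pr_x[j ∈ t.queries x]`,

in the vocabulary of the tree's KKL file (`LowDegree.KKL.variance`, `LowDegree.KKL.influence`) and of
`DecisionTree.queries`.  Derived from the two-function form `DecisionTree.osss_queries` with `F = [t accepts]`, `g = f = 2F − 1`
(then `2^N Σ F·f − (Σ F)(Σ f) = 4^N·Var[f]/2` and `Σₓ|f(x^{j→1}) − f(x^{j→0})| = 2·2^N·Infⱼ[f]`).

* `DecisionTree.sum_abs_update_eq_two_mul_influence` — the `L¹` increment of a `±1` function is `2·2^N·Infⱼ`;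
* **`DecisionTree.osss_variance`** — the OSSS inequality;
* `DecisionTree.osss_variance_depth` — the corollary `Var[f] ≤ depth(t)·M` for any common bound `M ≥ 0` of the influences
  (`Σⱼ δⱼ ≤ depth`).

## References
* R. O'Donnell, M. Saks, O. Schramm, R. A. Servedio, *Every decision tree has an influential variable*, FOCS 2005, Thm 1.1.
* R. O'Donnell, *Analysis of Boolean Functions*, Cambridge University Press 2014, §8.6.
-/

noncomputable section

namespace Literature.Computability.Complexity

open Finset Function LowDegree LowDegree.KKL

namespace DecisionTree

variable {N : ℕ}

/-- For a `±1`-valued `f`, `Σₓ |f(x^{j→1}) − f(x^{j→0})| = 2·2^N·Infⱼ[f]` (KKL influence `= Pr[f(x) ≠ f(x^{⊕j})]`).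
[cite: ODonnell2014, Def. 2.13] -/
theorem sum_abs_update_eq_two_mul_influence (f : (Fin N → Bool) → ℝ) (hf : ∀ x, f x = 1 ∨ f x = -1) (j : Fin N) :
    ∑ x, |f (update x j true) - f (update x j false)| = 2 * ((2 : ℝ) ^ N * KKL.influence j f) := by
  unfold KKL.influence
  rw [mul_div_cancel₀ _ (by positivity : (2 : ℝ) ^ N ≠ 0), Finset.mul_sum]
  refine Finset.sum_congr rfl fun x _ => ?_
  have habs : ∀ a b : ℝ, (a = 1 ∨ a = -1) → (b = 1 ∨ b = -1) → |a - b| = 2 * (if a ≠ b then 1 else 0) := by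
    intro a b ha hb
    rcases ha with rfl | rfl <;> rcases hb with rfl | rfl <;> norm_num
  rcases Bool.eq_false_or_eq_true (x j) with hx | hx
  · have hu : update x j true = x := by rw [← hx]; exact update_eq_self j x
    rw [hu, hx, Bool.not_true, habs _ _ (hf _) (hf _)]
  · have hu : update x j false = x := by rw [← hx]; exact update_eq_self j x
    rw [hu, hx, Bool.not_false, abs_sub_comm, habs _ _ (hf _) (hf _)]

/-- **The OSSS inequality** (O'Donnell–Saks–Schramm–Servedio): for a `±1`-valued `f` computed by the decision tree `t`
(`f(x) = 1` if `t` accepts `x`, `−1` otherwise), `Var[f] ≤ Σⱼ δⱼ(t)·Infⱼ[f]` with `δⱼ(t) = #{x : j ∈ t.queries x}/2^N` the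
probability that `t` queries `j` on a uniform input. [cite: OdonnellEtAl2005, Thm 1.1] [cite: ODonnell2014, §8.6] -/
theorem osss_variance (t : DecisionTree N) (f : (Fin N → Bool) → ℝ)
    (hf : ∀ x, f x = if t.eval x = true then (1 : ℝ) else -1) :
    KKL.variance f ≤ ∑ j, (((Finset.univ.filter fun x : Fin N → Bool => j ∈ t.queries x).card : ℝ) / (2 : ℝ) ^ N) *
      KKL.influence j f := by
  classical
  have hpm : ∀ x, f x = 1 ∨ f x = -1 := fun x => by rw [hf x]; split_ifs <;> simp
  set F : (Fin N → Bool) → ℝ := fun x => if t.eval x = true then (1 : ℝ) else 0 with hF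
  set M : Fin N → ℝ := fun j => 2 * ((2 : ℝ) ^ N * KKL.influence j f) with hM
  have hM0 : ∀ j, 0 ≤ M j := fun j => by
    simp only [hM]; exact mul_nonneg (by norm_num) (mul_nonneg (by positivity) (KKL.influence_nonneg j f))
  have hg : ∀ j : Fin N, ∑ x, |f (update x j true) - f (update x j false)| ≤ M j :=
    fun j => (sum_abs_update_eq_two_mul_influence f hpm j).le
  have key := osss_queries t F f M (fun x => rfl) hM0 hg
  -- the left side: `Σ F·f = Σ F = K`, `Σ f = 2K − 2^N`
  have h2N : (0 : ℝ) < (2 : ℝ) ^ N := by positivity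
  set K : ℝ := ∑ x, F x with hK
  have hFf : ∑ x, F x * f x = K := by
    refine Finset.sum_congr rfl fun x _ => ?_
    simp only [hF]; rw [hf x]; split_ifs <;> norm_num
  have hsf : ∑ x, f x = 2 * K - (2 : ℝ) ^ N := by
    have hpt : ∀ x, f x = 2 * F x - 1 := fun x => by simp only [hF]; rw [hf x]; split_ifs <;> norm_num
    rw [Finset.sum_congr rfl fun x _ => hpt x, Finset.sum_sub_distrib, ← Finset.mul_sum, Finset.sum_const,
      Finset.card_univ, Fintype.card_fun, Fintype.card_bool, Fintype.card_fin, nsmul_eq_mul, mul_one]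
    push_cast
    ring
  have hvar : KKL.variance f = 2 * ((2 : ℝ) ^ N * K - K * (2 * K - (2 : ℝ) ^ N)) / ((2 : ℝ) ^ N * (2 : ℝ) ^ N) := by
    rw [KKL.variance_eq f hpm, cubeFourierCoeff_empty, hsf]
    field_simp
    ring
  rw [hFf, hsf] at key
  -- the right side
  have hrhs : ∑ j, (((Finset.univ.filter fun x : Fin N → Bool => j ∈ t.queries x).card : ℝ) / (2 : ℝ) ^ N) *
      KKL.influence j f =
      2 * ((∑ j, ((Finset.univ.filter fun x : Fin N → Bool => j ∈ t.queries x).card : ℝ) * M j) / 4) /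
        ((2 : ℝ) ^ N * (2 : ℝ) ^ N) := by
    simp only [hM]
    rw [Finset.sum_div, Finset.mul_sum, Finset.sum_div]
    refine Finset.sum_congr rfl fun j _ => ?_
    field_simp
    ring
  rw [hvar, hrhs]
  exact div_le_div_of_nonneg_right (by linarith) (by positivity)

/-- Depth form: `Var[f] ≤ depth(t)·M` whenever every `Infⱼ[f] ≤ M` (`M ≥ 0`), since `Σⱼ δⱼ(t) ≤ depth(t)`
(`|t.queries x| ≤ depth`).
[cite: OdonnellEtAl2005, Thm 1.1] -/
theorem osss_variance_depth (t : DecisionTree N) (f : (Fin N → Bool) → ℝ)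
    (hf : ∀ x, f x = if t.eval x = true then (1 : ℝ) else -1) (Minf : ℝ) (hMinf : 0 ≤ Minf)
    (hInf : ∀ j, KKL.influence j f ≤ Minf) :
    KKL.variance f ≤ (t.depth : ℝ) * Minf := by
  classical
  have h2N : (0 : ℝ) < (2 : ℝ) ^ N := by positivity
  refine (osss_variance t f hf).trans ?_
  have hδ0 : ∀ j, 0 ≤ (((Finset.univ.filter fun x : Fin N → Bool => j ∈ t.queries x).card : ℝ) / (2 : ℝ) ^ N) :=
    fun j => by positivity
  calc ∑ j, (((Finset.univ.filter fun x : Fin N → Bool => j ∈ t.queries x).card : ℝ) / (2 : ℝ) ^ N) *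
        KKL.influence j f
      ≤ ∑ j, (((Finset.univ.filter fun x : Fin N → Bool => j ∈ t.queries x).card : ℝ) / (2 : ℝ) ^ N) * Minf :=
        Finset.sum_le_sum fun j _ => mul_le_mul_of_nonneg_left (hInf j) (hδ0 j)
    _ = (∑ j, ((Finset.univ.filter fun x : Fin N → Bool => j ∈ t.queries x).card : ℝ)) / (2 : ℝ) ^ N * Minf := by
        rw [← Finset.sum_mul, Finset.sum_div]
    _ ≤ (t.depth : ℝ) * Minf := by
        refine mul_le_mul_of_nonneg_right ?_ hMinf
        rw [div_le_iff₀ h2N]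
        -- `Σⱼ #{x : j queried} = Σₓ |t.queries x| ≤ 2^N · depth`
        have h : ∑ j, ((Finset.univ.filter fun x : Fin N → Bool => j ∈ t.queries x).card : ℝ) =
            ∑ x : Fin N → Bool, ((t.queries x).card : ℝ) := by
          simp_rw [← Finset.sum_boole (R := ℝ)]
          rw [Finset.sum_comm]
          refine Finset.sum_congr rfl fun x _ => ?_
          rw [Finset.sum_boole]
          simp
        rw [h]
        calc ∑ x : Fin N → Bool, ((t.queries x).card : ℝ) ≤ ∑ x : Fin N → Bool, (t.depth : ℝ) :=
              Finset.sum_le_sum fun x _ => by exact_mod_cast DecisionTree.card_queries_le_depth t x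
          _ = (t.depth : ℝ) * (2 : ℝ) ^ N := by
              rw [Finset.sum_const, Finset.card_univ, Fintype.card_fun, Fintype.card_bool, Fintype.card_fin, nsmul_eq_mul]
              push_cast; ring

end DecisionTree

end Literature.Computability.Complexity

end
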